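import Literature.IUT.HodgeTheaters.GoodLocalFrobenioidOfPlaceSlim
import Literature.AlgebraicGeometry.Frobenioids.Cor411Padic
import HarnessLib

/-!
# [IUTchI] Example 3.3 / Corollary 5.3 (ii): [FrdI] Corollary 4.11 ON EQUIVALENCES of the REAL good-place Frobenioids
# `C_v = ℱ̲_v` over `D_v = 𝓑(Π_v)⁰` — the `1`-unique `Ψ^Base : 𝓑(Π¹_v)⁰ ⥲ 𝓑(Π²_v)⁰` under every `Ψ : C¹_v ⥲ C²_v`
# (existence and essential uniqueness of the equivalence of bases lying under `Ψ`)

S. Mochizuki, *Inter-universal Teichmüller theory I*, kurims manuscript (May 2020), Example 3.3 (i) p. 78 ("`p_v`-adic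
Frobenioids `𝒞⊢_v ⊆ 𝒞_v` … whose base categories are given by `𝒟⊢_v`, `𝒟_v`"), Corollary 5.3 (ii) p. 144 l. 14–18
("the natural map `Isom(¹𝔉, ²𝔉) → Isom(¹𝔇, ²𝔇)` is bijective"; proof l. 36–39 "for `v ∈ 𝕍^non` … [cf. [AbsTopIII]
Prop 3.2 (iv)]") ([IUTchI] Cor 5.3 p.144) [claim: Mochizuki2012, status: disputed] — nothing of the series is asserted
and no side is taken on [IUTchIII] Cor. 3.12.  The mathematics is S. Mochizuki, *The geometry of Frobenioids I*,
Kyushu J. Math. **62** (2008), Cor. 4.11 pp. 91–92 [cite: MochizukiFrdI2008, Cor. 4.11 p.91], and *The geometry of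
Frobenioids II*, Kyushu J. Math. **62** (2008), Ex. 1.1 / Thm. 1.2 (i) pp. 7–9, Ex. 1.3 (i) p. 11
[cite: MochizukiFrdII2008, Ex 1.3 (i) p.11].

PROOF-ONLY file (cell abc-iut; seat abc-iut-w4-d109, author of `Cor411Padic.lean` / `Cor411PadicTempered.lean`; L5 hub
H2 row T3 «COR411-ON-EQUIV-AT-REAL-CV» keyed by abc-iut-L5-lead g8 RULINGS #111b / abc-iut-L5-t4 g6), 0 definitions.
The "natural map `Isom(−) → Isom(Base(−))`" of Cor. 5.3 needs, at each good nonarchimedean `v`, that UNDER every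
equivalence `Ψ : C¹_v ⥲ C²_v` there lies an equivalence of bases `Θ : 𝒟¹_v ⥲ 𝒟²_v` (`Ψ ⋙ Base₂ ≅ Base₁ ⋙ Θ`), unique
up to isomorphism — abc-iut-L5-t4's displayed binders `CatIsomorphism.HasUnder` / `UnderUnique`
(`ConventionsCatIsomorphismGroup.lean`).  This is EXACTLY [FrdI] Cor. 4.11 (ii)'s `1`-unique square, and for the REAL
carrier it is a theorem of the tree's layer L1:

* §1 — for ANY `p`-adic Frobenioid data `Q_i : PadicFrd.Datum (CosetCat Π_i) p_i` over the REAL coset bases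
  `𝓑(Π_i)⁰ = CosetCat Π_i` ([FrdII] Ex. 1.3 (i): of FSM-type, `CosetCat.isOfFSMType`): the TYPED Cor. 4.11 (ii) for every
  `Ψ` UNCONDITIONALLY (`PadicFrd.cor411ii_padic`); and — given slim coset categories (⟸ `Π_i` slim profinite,
  abc-iut-L1-t4's `PadicFrd.isSlim_cosetCat_of_isSlimGroup`; print's "[AbsAnab] Lem. 1.3.1") — `Cor411Setting`, the
  `1`-unique `Ψ^Base` with rigid composites (`exists_oneUniqueSquare_base_padic`), the existence / essential-uniqueness
  statements in the shape of `HasUnder` / `UnderUnique` (stated UNFOLDED here, since the §0 file's olean was not yet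
  live at filing time; the named binders follow by `Iff.rfl`), "`Ψ` preserves `deg_Fr`", the Cor. 4.11 (iv) data
  `(Ψ^Base, η, Ψ^Φ)` with the divisor formula (the binders `ΨBase η hdeg` of abc-iut-L5-t16's unit-transport files),
  and Cor. 4.11 (i);
* §2 — the same read at abc-iut-L5-t2's REAL instance `GoodLocalFrobenioid.ofGalois` ([IUTchI] Ex. 3.3 over
  `𝓑(Π_v)⁰ ⊇ 𝓑(G_v)⁰`, `C_v` = the [FrdII] kit Frobenioid of `Φ_{C_v} = ord(𝒪^▷)^pf`): for every
  `Ψ : C¹_v ⥲ C²_v` a `1`-unique `Ψ^Base : 𝓑(Π¹_v)⁰ ⥲ 𝓑(Π²_v)⁰` lying under `Ψ` w.r.t. the structure functors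
  `toBase`, modulo ONLY the slimness of `Π¹_v, Π²_v` (displayed; no new named fact);
* §3 — with NO hypothesis at the genuine witnesses `ofPadicGalois p` (`K_v = ℚ_p`, `Π_v = G_{ℚ_p}`, slim by the
  tree's [pGC] Lem. 15.8) and at the actual places `ofGalois (GaloisValDatum.ofPlace F p v hv) …` for EVERY slim
  `Π_v ↠ G_v = Gal(F̄_v/F_v)`.

HONEST LIMITS.  This is the EXISTENCE + ESSENTIAL UNIQUENESS of the base equivalence (so the natural map of Cor. 5.3
(ii) is REAL at good `v`); it is NOT the bijectivity of that map (injectivity = [AbsTopIII] Prop 3.2 (iv) / rows N1–N3,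
surjectivity = the pair-lifting schema F-0409).  Nothing here bears on [IUTchIII] Cor. 3.12; typed ≠ proved elsewhere.
-/

noncomputable section

-- `(PreFrobenioidData.ofFunctor Φ F).base` / `ModelFrobenioid.data` / `GoodLocalFrobenioid.ofGalois` fields unfold
-- only at default transparency (cf. the same option in `GoodLocalFrobenioidOfKitBases.lean`).
set_option backward.isDefEq.respectTransparency false

namespace Literature.IUT.HodgeTheaters

open CategoryTheory Literature.AnabelianGeometry.SemiGraphs Literature.AlgebraicGeometry.Frobenioids
open Literature.AlgebraicGeometry.Frobenioids.PadicFrd Literature.AlgebraicGeometry.Frobenioids.PreFrobenioidData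

universe u

namespace GoodLocalFrobenioid

/-! ### §1. `p`-adic Frobenioids over the REAL coset bases `𝓑(Π)⁰ = CosetCat Π` -/

section CosetData

variable {P₁ : Type u} [Group P₁] [TopologicalSpace P₁] [IsTopologicalGroup P₁]
  {P₂ : Type u} [Group P₂] [TopologicalSpace P₂] [IsTopologicalGroup P₂]
  {p₁ p₂ : ℕ} [Fact p₁.Prime] [Fact p₂.Prime]
  (Q₁ : Datum (CosetCat P₁) p₁) (Q₂ : Datum (CosetCat P₂) p₂)

/-- **[FrdI] Cor. 4.11 (ii) AS TYPED, UNCONDITIONALLY, for every equivalence `Ψ : C₁ ⥲ C₂` of `p`-adic Frobenioids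
over the REAL coset bases `𝓑(Π_i)⁰`** ([FrdII] Ex. 1.3 (i): `CosetCat Π` is of FSM-type; abc-iut-w4-d109's
`PadicFrd.cor411ii_padic`). ([IUTchI] Cor 5.3 p.144) [claim: Mochizuki2012, status: disputed] -/
theorem cor411ii_cosetCat (Ψ : Q₁.frobenioid ≌ Q₂.frobenioid) :
    (ModelFrobenioid.data Q₁.Φ Q₁.B Q₁.divB).Cor411ii (ModelFrobenioid.data Q₂.Φ Q₂.B Q₂.divB) Ψ :=
  cor411ii_padic Q₁ Q₂ CosetCat.isOfFSMType CosetCat.isOfFSMType Ψ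

/-- **The hypothesis package of [FrdI] Cor. 4.11 HOLDS over slim coset bases** (Div-slim ⟸ slim; standard type =
[FrdII] Thm. 1.2 (i); (b) idle). ([IUTchI] Cor 5.3 p.144) [claim: Mochizuki2012, status: disputed] -/
theorem cor411Setting_cosetCat (hsl₁ : IsSlim (CosetCat P₁)) (hsl₂ : IsSlim (CosetCat P₂))
    (Ψ : Q₁.frobenioid ≌ Q₂.frobenioid) :
    (ModelFrobenioid.data Q₁.Φ Q₁.B Q₁.divB).Cor411Setting (ModelFrobenioid.data Q₂.Φ Q₂.B Q₂.divB) Ψ :=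
  cor411Setting_padic Q₁ Q₂ CosetCat.isOfFSMType CosetCat.isOfFSMType hsl₁ hsl₂ Ψ

/-- **The `1`-unique `Ψ^Base : 𝓑(Π₁)⁰ ⥲ 𝓑(Π₂)⁰` induced by `Ψ`**, with both composite functors rigid, over slim coset
bases ([FrdI] Cor. 4.11 (ii) p. 91). ([IUTchI] Cor 5.3 p.144) [claim: Mochizuki2012, status: disputed] -/
theorem exists_oneUniqueSquare_base_cosetCat (hsl₁ : IsSlim (CosetCat P₁)) (hsl₂ : IsSlim (CosetCat P₂))
    (Ψ : Q₁.frobenioid ≌ Q₂.frobenioid) :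
    ∃ ΨBase : CosetCat P₁ ⥤ CosetCat P₂,
      OneUniqueSquare Ψ.functor (ModelFrobenioid.data Q₁.Φ Q₁.B Q₁.divB).base
          (ModelFrobenioid.data Q₂.Φ Q₂.B Q₂.divB).base ΨBase ∧
        IsRigidFunctor (Ψ.functor ⋙ (ModelFrobenioid.data Q₂.Φ Q₂.B Q₂.divB).base) ∧
        IsRigidFunctor ((ModelFrobenioid.data Q₁.Φ Q₁.B Q₁.divB).base ⋙ ΨBase) :=
  exists_oneUniqueSquare_base_padic Q₁ Q₂ CosetCat.isOfFSMType CosetCat.isOfFSMType hsl₁ hsl₂ Ψ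

/-- **EXISTENCE of an equivalence of bases lying under `Ψ`** (the content of abc-iut-L5-t4's binder
`CatIsomorphism.HasUnder Base₁ Base₂`, unfolded): under every `Ψ : C₁ ⥲ C₂` lies SOME `Θ : 𝓑(Π₁)⁰ ⥲ 𝓑(Π₂)⁰` with
`Ψ ⋙ Base₂ ≅ Base₁ ⋙ Θ`. ([IUTchI] Cor 5.3 p.144) [claim: Mochizuki2012, status: disputed] -/
theorem exists_equivalence_under_base_cosetCat (hsl₁ : IsSlim (CosetCat P₁)) (hsl₂ : IsSlim (CosetCat P₂))
    (Ψ : Q₁.frobenioid ≌ Q₂.frobenioid) :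
    ∃ Θ : CosetCat P₁ ≌ CosetCat P₂,
      Nonempty (Ψ.functor ⋙ (ModelFrobenioid.data Q₂.Φ Q₂.B Q₂.divB).base ≅
        (ModelFrobenioid.data Q₁.Φ Q₁.B Q₁.divB).base ⋙ Θ.functor) := by
  obtain ⟨ΨBase, ⟨hE, hc, -⟩, -⟩ := exists_oneUniqueSquare_base_cosetCat Q₁ Q₂ hsl₁ hsl₂ Ψ
  haveI := hE
  exact ⟨ΨBase.asEquivalence, hc⟩

/-- **ESSENTIAL UNIQUENESS of the equivalence of bases lying under `Ψ`** (the content of abc-iut-L5-t4's binder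
`CatIsomorphism.UnderUnique Base₁ Base₂`, unfolded): two equivalences `Θ, Θ'` of the coset bases both lying under
`Ψ` are isomorphic — each is isomorphic to the `1`-unique `Ψ^Base`. ([IUTchI] Cor 5.3 p.144) [claim: Mochizuki2012, status: disputed] -/
theorem nonempty_iso_of_under_base_cosetCat (hsl₁ : IsSlim (CosetCat P₁)) (hsl₂ : IsSlim (CosetCat P₂))
    (Ψ : Q₁.frobenioid ≌ Q₂.frobenioid) (Θ Θ' : CosetCat P₁ ≌ CosetCat P₂)
    (h : Nonempty (Ψ.functor ⋙ (ModelFrobenioid.data Q₂.Φ Q₂.B Q₂.divB).base ≅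
      (ModelFrobenioid.data Q₁.Φ Q₁.B Q₁.divB).base ⋙ Θ.functor))
    (h' : Nonempty (Ψ.functor ⋙ (ModelFrobenioid.data Q₂.Φ Q₂.B Q₂.divB).base ≅
      (ModelFrobenioid.data Q₁.Φ Q₁.B Q₁.divB).base ⋙ Θ'.functor)) :
    Nonempty (Θ.functor ≅ Θ'.functor) := by
  obtain ⟨ΨBase, ⟨-, -, huniq⟩, -⟩ := exists_oneUniqueSquare_base_cosetCat Q₁ Q₂ hsl₁ hsl₂ Ψ
  obtain ⟨e⟩ := huniq Θ.functor h
  obtain ⟨e'⟩ := huniq Θ'.functor h'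
  exact ⟨e ≪≫ e'.symm⟩

/-- **"`Ψ` preserves Frobenius degrees"** ([FrdI] Thm. 3.4 (iii) / Cor. 4.11 (iv)) over slim coset bases — the binder
`hdeg` of abc-iut-L5-t16's unit-transport files at the genuine datum. ([IUTchI] Cor 5.3 p.144) [claim: Mochizuki2012, status: disputed] -/
theorem preservesDegFr_cosetCat (hsl₁ : IsSlim (CosetCat P₁)) (hsl₂ : IsSlim (CosetCat P₂))
    (Ψ : Q₁.frobenioid ≌ Q₂.frobenioid) :
    PreservesDegFr (ModelFrobenioid.data Q₁.Φ Q₁.B Q₁.divB) (ModelFrobenioid.data Q₂.Φ Q₂.B Q₂.divB) Ψ := by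
  obtain ⟨-, -, -, -, hdeg, -⟩ := exists_cor411iv_data_padic Q₁ Q₂ CosetCat.isOfFSMType CosetCat.isOfFSMType hsl₁ hsl₂ Ψ
  exact hdeg

/-- **[FrdI] Cor. 4.11 (iv), the consumer data `(Ψ^Base, η, Ψ^Φ)` over slim coset bases**: an equivalence `Ψ^Base`,
`η : Base₂ ∘ Ψ ≅ Ψ^Base ∘ Base₁`, a divisor-monoid isomorphism `Ψ^Φ` over `Ψ^Base`, `deg_Fr` preserved, the divisor
formula `Div(Ψ φ) = η_A^* Ψ^Φ(Div φ)` on every arrow, rigid composites — abc-iut-w4-d109's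
`PadicFrd.exists_cor411iv_data_padic`; these are the binders `ΨBase η hdeg` of abc-iut-L5-t16's
`GoodLocalFrobenioidOfGaloisUnitTransport*` DISCHARGED at the genuine datum. ([IUTchI] Cor 5.3 p.144) [claim: Mochizuki2012, status: disputed] -/
theorem exists_cor411iv_data_cosetCat (hsl₁ : IsSlim (CosetCat P₁)) (hsl₂ : IsSlim (CosetCat P₂))
    (Ψ : Q₁.frobenioid ≌ Q₂.frobenioid) :
    ∃ (ΨBase : CosetCat P₁ ⥤ CosetCat P₂)
      (E : DivisorMonoidIsoOverBase (ModelFrobenioid.data Q₁.Φ Q₁.B Q₁.divB)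
        (ModelFrobenioid.data Q₂.Φ Q₂.B Q₂.divB) ΨBase)
      (η : Ψ.functor ⋙ (ModelFrobenioid.data Q₂.Φ Q₂.B Q₂.divB).base ≅
        (ModelFrobenioid.data Q₁.Φ Q₁.B Q₁.divB).base ⋙ ΨBase),
      ΨBase.IsEquivalence ∧
        PreservesDegFr (ModelFrobenioid.data Q₁.Φ Q₁.B Q₁.divB) (ModelFrobenioid.data Q₂.Φ Q₂.B Q₂.divB) Ψ ∧
        (∀ ⦃A B : Q₁.frobenioid⦄ (φ : A ⟶ B),
          (ModelFrobenioid.data Q₂.Φ Q₂.B Q₂.divB).div (Ψ.functor.map φ) =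
            (ModelFrobenioid.data Q₂.Φ Q₂.B Q₂.divB).pull (η.hom.app A)
              (E.iso ((ModelFrobenioid.data Q₁.Φ Q₁.B Q₁.divB).base.obj A)
                ((ModelFrobenioid.data Q₁.Φ Q₁.B Q₁.divB).div φ))) ∧
        (IsRigidFunctor (Ψ.functor ⋙ (ModelFrobenioid.data Q₂.Φ Q₂.B Q₂.divB).base) ∧
          IsRigidFunctor ((ModelFrobenioid.data Q₁.Φ Q₁.B Q₁.divB).base ⋙ ΨBase)) :=
  exists_cor411iv_data_padic Q₁ Q₂ CosetCat.isOfFSMType CosetCat.isOfFSMType hsl₁ hsl₂ Ψ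

/-- **[FrdI] Cor. 4.11 (i) over slim coset bases**: `Ψ^istr` and the `1`-unique `Ψ^un-tr`.
([IUTchI] Cor 5.3 p.144) [claim: Mochizuki2012, status: disputed] -/
theorem exists_cor411i_cosetCat (hsl₁ : IsSlim (CosetCat P₁)) (hsl₂ : IsSlim (CosetCat P₂))
    (Ψ : Q₁.frobenioid ≌ Q₂.frobenioid) :
    ∃ Ψistr : (ModelFrobenioid.data Q₁.Φ Q₁.B Q₁.divB).Istr ≌ (ModelFrobenioid.data Q₂.Φ Q₂.B Q₂.divB).Istr,
      Ψistr.functor ⋙ (ModelFrobenioid.data Q₂.Φ Q₂.B Q₂.divB).istrι =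
          (ModelFrobenioid.data Q₁.Φ Q₁.B Q₁.divB).istrι ⋙ Ψ.functor ∧
        (ModelFrobenioid.data Q₁.Φ Q₁.B Q₁.divB).Cor411i (ModelFrobenioid.data Q₂.Φ Q₂.B Q₂.divB) Ψ
          Ψistr.functor :=
  exists_cor411i_padic Q₁ Q₂ CosetCat.isOfFSMType CosetCat.isOfFSMType hsl₁ hsl₂ Ψ

/-- **Group form of the slimness hypothesis** (print: "[AbsAnab] Lem. 1.3.1", `Π_v` slim): for slim PROFINITE `Π₁, Π₂`
the `1`-unique `Ψ^Base` exists for every `Ψ` — abc-iut-L1-t4's `PadicFrd.isSlim_cosetCat_of_isSlimGroup`.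
([IUTchI] Cor 5.3 p.144) [claim: Mochizuki2012, status: disputed] -/
theorem exists_oneUniqueSquare_base_cosetCat_of_isSlimGroup [CompactSpace P₁] [TotallyDisconnectedSpace P₁]
    [CompactSpace P₂] [TotallyDisconnectedSpace P₂] (hZ₁ : IsSlimGroup P₁) (hZ₂ : IsSlimGroup P₂)
    (Ψ : Q₁.frobenioid ≌ Q₂.frobenioid) :
    ∃ ΨBase : CosetCat P₁ ⥤ CosetCat P₂,
      OneUniqueSquare Ψ.functor (ModelFrobenioid.data Q₁.Φ Q₁.B Q₁.divB).base
          (ModelFrobenioid.data Q₂.Φ Q₂.B Q₂.divB).base ΨBase ∧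
        IsRigidFunctor (Ψ.functor ⋙ (ModelFrobenioid.data Q₂.Φ Q₂.B Q₂.divB).base) ∧
        IsRigidFunctor ((ModelFrobenioid.data Q₁.Φ Q₁.B Q₁.divB).base ⋙ ΨBase) :=
  exists_oneUniqueSquare_base_cosetCat Q₁ Q₂ (isSlim_cosetCat_of_isSlimGroup hZ₁)
    (isSlim_cosetCat_of_isSlimGroup hZ₂) Ψ

end CosetData

/-! ### §2. At the REAL instance `GoodLocalFrobenioid.ofGalois`: `C_v` over `D_v = 𝓑(Π_v)⁰` -/

section OfGalois

variable {p₁ : ℕ} [Fact p₁.Prime] (d₁ : GaloisValDatum.{u} p₁) {P₁ : Type u} [Group P₁] [TopologicalSpace P₁]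
  (aug₁ : P₁ →* d₁.Gal) (hc₁ : Continuous aug₁) (hs₁ : Function.Surjective aug₁) (ho₁ : IsOpenMap aug₁)
  (Kv₁ : Type) [Field Kv₁] [ValuativeRel Kv₁] (hp₁ : ((p₁ : Kv₁)) ∈ PadicFrd.intNonzero Kv₁)
variable {p₂ : ℕ} [Fact p₂.Prime] (d₂ : GaloisValDatum.{u} p₂) {P₂ : Type u} [Group P₂] [TopologicalSpace P₂]
  (aug₂ : P₂ →* d₂.Gal) (hc₂ : Continuous aug₂) (hs₂ : Function.Surjective aug₂) (ho₂ : IsOpenMap aug₂)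
  (Kv₂ : Type) [Field Kv₂] [ValuativeRel Kv₂] (hp₂ : ((p₂ : Kv₂)) ∈ PadicFrd.intNonzero Kv₂)

/-- **[IUTchI] Ex. 3.3 / Cor. 5.3 (ii) at good `v`, over the REAL bases: under EVERY equivalence `Ψ : C¹_v ⥲ C²_v` of
the Frobenioids of two instances `ofGalois` there lies a `1`-UNIQUE equivalence `Ψ^Base : 𝓑(Π¹_v)⁰ ⥲ 𝓑(Π²_v)⁰` of
the bases** (`Ψ ⋙ toBase₂ ≅ toBase₁ ⋙ Ψ^Base`, `1`-unique; both composites rigid), as soon as the coset categories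
`𝓑(Πⁱ_v)⁰` are slim — [FrdI] Cor. 4.11 (ii) at the [FrdII] kit Frobenioid of `Φ_{C_v} = ord(𝒪^▷)^pf` over
`CosetCat Π_v` ([IUTchI] Ex. 3.3 (i) "`p_v`-adic Frobenioids … whose base categories are given by `𝒟_v`").
([IUTchI] Cor 5.3 p.144) [claim: Mochizuki2012, status: disputed] -/
theorem exists_oneUniqueSquare_toBase_ofGalois [IsTopologicalGroup P₁] [IsTopologicalGroup P₂]
    (hsl₁ : IsSlim (CosetCat P₁)) (hsl₂ : IsSlim (CosetCat P₂))
    (Ψ : (ofGalois d₁ aug₁ hc₁ hs₁ ho₁ Kv₁ hp₁).Cv ≌ (ofGalois d₂ aug₂ hc₂ hs₂ ho₂ Kv₂ hp₂).Cv) :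
    ∃ ΨBase : CosetCat P₁ ⥤ CosetCat P₂,
      OneUniqueSquare Ψ.functor (ofGalois d₁ aug₁ hc₁ hs₁ ho₁ Kv₁ hp₁).toBase
          (ofGalois d₂ aug₂ hc₂ hs₂ ho₂ Kv₂ hp₂).toBase ΨBase ∧
        IsRigidFunctor (Ψ.functor ⋙ (ofGalois d₂ aug₂ hc₂ hs₂ ho₂ Kv₂ hp₂).toBase) ∧
        IsRigidFunctor ((ofGalois d₁ aug₁ hc₁ hs₁ ho₁ Kv₁ hp₁).toBase ⋙ ΨBase) :=
  exists_oneUniqueSquare_base_cosetCat _ _ hsl₁ hsl₂ Ψ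

/-- **EXISTENCE half (`HasUnder toBase₁ toBase₂`, unfolded) at `ofGalois`**: under every `Ψ : C¹_v ⥲ C²_v` lies some
`Θ : 𝓑(Π¹_v)⁰ ⥲ 𝓑(Π²_v)⁰`. ([IUTchI] Cor 5.3 p.144) [claim: Mochizuki2012, status: disputed] -/
theorem exists_equivalence_under_toBase_ofGalois [IsTopologicalGroup P₁] [IsTopologicalGroup P₂]
    (hsl₁ : IsSlim (CosetCat P₁)) (hsl₂ : IsSlim (CosetCat P₂))
    (Ψ : (ofGalois d₁ aug₁ hc₁ hs₁ ho₁ Kv₁ hp₁).Cv ≌ (ofGalois d₂ aug₂ hc₂ hs₂ ho₂ Kv₂ hp₂).Cv) :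
    ∃ Θ : CosetCat P₁ ≌ CosetCat P₂,
      Nonempty (Ψ.functor ⋙ (ofGalois d₂ aug₂ hc₂ hs₂ ho₂ Kv₂ hp₂).toBase ≅
        (ofGalois d₁ aug₁ hc₁ hs₁ ho₁ Kv₁ hp₁).toBase ⋙ Θ.functor) :=
  exists_equivalence_under_base_cosetCat _ _ hsl₁ hsl₂ Ψ

/-- **UNIQUENESS half (`UnderUnique toBase₁ toBase₂`, unfolded) at `ofGalois`**: two equivalences of the bases lying
under the same `Ψ` are isomorphic. ([IUTchI] Cor 5.3 p.144) [claim: Mochizuki2012, status: disputed] -/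
theorem nonempty_iso_of_under_toBase_ofGalois [IsTopologicalGroup P₁] [IsTopologicalGroup P₂]
    (hsl₁ : IsSlim (CosetCat P₁)) (hsl₂ : IsSlim (CosetCat P₂))
    (Ψ : (ofGalois d₁ aug₁ hc₁ hs₁ ho₁ Kv₁ hp₁).Cv ≌ (ofGalois d₂ aug₂ hc₂ hs₂ ho₂ Kv₂ hp₂).Cv)
    (Θ Θ' : CosetCat P₁ ≌ CosetCat P₂)
    (h : Nonempty (Ψ.functor ⋙ (ofGalois d₂ aug₂ hc₂ hs₂ ho₂ Kv₂ hp₂).toBase ≅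
      (ofGalois d₁ aug₁ hc₁ hs₁ ho₁ Kv₁ hp₁).toBase ⋙ Θ.functor))
    (h' : Nonempty (Ψ.functor ⋙ (ofGalois d₂ aug₂ hc₂ hs₂ ho₂ Kv₂ hp₂).toBase ≅
      (ofGalois d₁ aug₁ hc₁ hs₁ ho₁ Kv₁ hp₁).toBase ⋙ Θ'.functor)) :
    Nonempty (Θ.functor ≅ Θ'.functor) :=
  nonempty_iso_of_under_base_cosetCat _ _ hsl₁ hsl₂ Ψ Θ Θ' h h'

/-- **Group form** (print's "[AbsAnab] Lem. 1.3.1": the arithmetic fundamental groups `Π¹_v, Π²_v` are slim): for slim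
profinite `Πⁱ_v` every `Ψ : C¹_v ⥲ C²_v` has a `1`-unique `Ψ^Base` under it at `ofGalois`.
([IUTchI] Cor 5.3 p.144) [claim: Mochizuki2012, status: disputed] -/
theorem exists_oneUniqueSquare_toBase_ofGalois_of_isSlimGroup [IsTopologicalGroup P₁] [CompactSpace P₁]
    [TotallyDisconnectedSpace P₁] [IsTopologicalGroup P₂] [CompactSpace P₂] [TotallyDisconnectedSpace P₂]
    (hZ₁ : IsSlimGroup P₁) (hZ₂ : IsSlimGroup P₂)
    (Ψ : (ofGalois d₁ aug₁ hc₁ hs₁ ho₁ Kv₁ hp₁).Cv ≌ (ofGalois d₂ aug₂ hc₂ hs₂ ho₂ Kv₂ hp₂).Cv) :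
    ∃ ΨBase : CosetCat P₁ ⥤ CosetCat P₂,
      OneUniqueSquare Ψ.functor (ofGalois d₁ aug₁ hc₁ hs₁ ho₁ Kv₁ hp₁).toBase
          (ofGalois d₂ aug₂ hc₂ hs₂ ho₂ Kv₂ hp₂).toBase ΨBase ∧
        IsRigidFunctor (Ψ.functor ⋙ (ofGalois d₂ aug₂ hc₂ hs₂ ho₂ Kv₂ hp₂).toBase) ∧
        IsRigidFunctor ((ofGalois d₁ aug₁ hc₁ hs₁ ho₁ Kv₁ hp₁).toBase ⋙ ΨBase) :=
  exists_oneUniqueSquare_toBase_ofGalois d₁ aug₁ hc₁ hs₁ ho₁ Kv₁ hp₁ d₂ aug₂ hc₂ hs₂ ho₂ Kv₂ hp₂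
    (isSlim_cosetCat_of_isSlimGroup hZ₁) (isSlim_cosetCat_of_isSlimGroup hZ₂) Ψ

end OfGalois

/-! ### §3. Hypothesis-free at the genuine witnesses -/

section OfPadicGalois

variable (p₁ p₂ : ℕ) [Fact p₁.Prime] [Fact p₂.Prime]

/-- **No hypothesis at the genuine `p`-adic witnesses** `K_v = ℚ_{p_i}`, `Ω = ℚ̄_{p_i}`, `Π_v := G_{ℚ_{p_i}}`
(`ofPadicGalois`): every `Ψ : C¹_v ⥲ C²_v` has a `1`-unique `Ψ^Base : 𝓑(G_{ℚ_{p₁}})⁰ ⥲ 𝓑(G_{ℚ_{p₂}})⁰` under it —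
`G_{ℚ_p}` is slim ([pGC] Lem. 15.8, abc-iut-L4; `PadicFrd.isSlim_cosetCat_galQp`).
([IUTchI] Cor 5.3 p.144) [claim: Mochizuki2012, status: disputed] -/
theorem exists_oneUniqueSquare_toBase_ofPadicGalois (Ψ : (ofPadicGalois p₁).Cv ≌ (ofPadicGalois p₂).Cv) :
    ∃ ΨBase : CosetCat (QuasiTemperoid.GalFbar ℚ_[p₁]) ⥤ CosetCat (QuasiTemperoid.GalFbar ℚ_[p₂]),
      OneUniqueSquare Ψ.functor (ofPadicGalois p₁).toBase (ofPadicGalois p₂).toBase ΨBase ∧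
        IsRigidFunctor (Ψ.functor ⋙ (ofPadicGalois p₂).toBase) ∧
        IsRigidFunctor ((ofPadicGalois p₁).toBase ⋙ ΨBase) :=
  exists_oneUniqueSquare_base_cosetCat _ _ (isSlim_cosetCat_galQp p₁) (isSlim_cosetCat_galQp p₂) Ψ

end OfPadicGalois

section OfPlace

open Literature.NumberTheory.NumberFields IsDedekindDomain NumberField

variable (F₁ : Type) [Field F₁] [NumberField F₁] (p₁ : ℕ) [Fact p₁.Prime] (v₁ : HeightOneSpectrum (𝓞 F₁))
  (hv₁ : ((p₁ : ℕ) : 𝓞 F₁) ∈ v₁.asIdeal)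
  {P₁ : Type} [Group P₁] [TopologicalSpace P₁] [IsTopologicalGroup P₁] [CompactSpace P₁] [TotallyDisconnectedSpace P₁]
  (aug₁ : P₁ →* (GaloisValDatum.ofPlace F₁ p₁ v₁ hv₁).Gal) (hc₁ : Continuous aug₁) (hs₁ : Function.Surjective aug₁)
  (ho₁ : IsOpenMap aug₁) (Kv₁ : Type) [Field Kv₁] [ValuativeRel Kv₁] (hp₁ : ((p₁ : Kv₁)) ∈ PadicFrd.intNonzero Kv₁)
variable (F₂ : Type) [Field F₂] [NumberField F₂] (p₂ : ℕ) [Fact p₂.Prime] (v₂ : HeightOneSpectrum (𝓞 F₂))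
  (hv₂ : ((p₂ : ℕ) : 𝓞 F₂) ∈ v₂.asIdeal)
  {P₂ : Type} [Group P₂] [TopologicalSpace P₂] [IsTopologicalGroup P₂] [CompactSpace P₂] [TotallyDisconnectedSpace P₂]
  (aug₂ : P₂ →* (GaloisValDatum.ofPlace F₂ p₂ v₂ hv₂).Gal) (hc₂ : Continuous aug₂) (hs₂ : Function.Surjective aug₂)
  (ho₂ : IsOpenMap aug₂) (Kv₂ : Type) [Field Kv₂] [ValuativeRel Kv₂] (hp₂ : ((p₂ : Kv₂)) ∈ PadicFrd.intNonzero Kv₂)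

/-- **At ACTUAL good nonarchimedean places** `K_v := (Fᵢ)_{vᵢ}`, `Ω := F̄ᵢ,vᵢ` (the `K_v` of [IUTchI] Def. 3.1 (e)), for
EVERY pair of slim profinite `Πⁱ_v ↠ G_{vᵢ}` (print: the arithmetic fundamental groups of `X̲→_v`, slim by [AbsAnab]
Lem. 1.3.1 — displayed): every `Ψ : C¹_v ⥲ C²_v` has a `1`-unique `Ψ^Base : 𝓑(Π¹_v)⁰ ⥲ 𝓑(Π²_v)⁰` under it.
([IUTchI] Cor 5.3 p.144) [claim: Mochizuki2012, status: disputed] -/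
theorem exists_oneUniqueSquare_toBase_ofGalois_ofPlace (hZ₁ : IsSlimGroup P₁) (hZ₂ : IsSlimGroup P₂)
    (Ψ : (ofGalois (GaloisValDatum.ofPlace F₁ p₁ v₁ hv₁) aug₁ hc₁ hs₁ ho₁ Kv₁ hp₁).Cv ≌
      (ofGalois (GaloisValDatum.ofPlace F₂ p₂ v₂ hv₂) aug₂ hc₂ hs₂ ho₂ Kv₂ hp₂).Cv) :
    ∃ ΨBase : CosetCat P₁ ⥤ CosetCat P₂,
      OneUniqueSquare Ψ.functor (ofGalois (GaloisValDatum.ofPlace F₁ p₁ v₁ hv₁) aug₁ hc₁ hs₁ ho₁ Kv₁ hp₁).toBase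
          (ofGalois (GaloisValDatum.ofPlace F₂ p₂ v₂ hv₂) aug₂ hc₂ hs₂ ho₂ Kv₂ hp₂).toBase ΨBase ∧
        IsRigidFunctor
          (Ψ.functor ⋙ (ofGalois (GaloisValDatum.ofPlace F₂ p₂ v₂ hv₂) aug₂ hc₂ hs₂ ho₂ Kv₂ hp₂).toBase) ∧
        IsRigidFunctor
          ((ofGalois (GaloisValDatum.ofPlace F₁ p₁ v₁ hv₁) aug₁ hc₁ hs₁ ho₁ Kv₁ hp₁).toBase ⋙ ΨBase) :=
  exists_oneUniqueSquare_toBase_ofGalois_of_isSlimGroup _ aug₁ hc₁ hs₁ ho₁ Kv₁ hp₁ _ aug₂ hc₂ hs₂ ho₂ Kv₂ hp₂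
    hZ₁ hZ₂ Ψ

/-- **With NO hypothesis at all when `Π_v := G_v` (no covering)** at two actual places: `G_{vᵢ} = Gal(F̄ᵢ,vᵢ/Fᵢ,vᵢ)` is
slim ([AbsAnab] Thm. 1.1.1 (ii), abc-iut-L4's `galoisMLF_slim_holds`; `isSlimGroup_gal_ofPlace`).
([IUTchI] Cor 5.3 p.144) [claim: Mochizuki2012, status: disputed] -/
theorem exists_oneUniqueSquare_toBase_ofGalois_ofPlace_self
    (Ψ : (ofGalois (GaloisValDatum.ofPlace F₁ p₁ v₁ hv₁) (MonoidHom.id _) continuous_id Function.surjective_id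
          IsOpenMap.id Kv₁ hp₁).Cv ≌
      (ofGalois (GaloisValDatum.ofPlace F₂ p₂ v₂ hv₂) (MonoidHom.id _) continuous_id Function.surjective_id
          IsOpenMap.id Kv₂ hp₂).Cv) :
    ∃ ΨBase : CosetCat (GaloisValDatum.ofPlace F₁ p₁ v₁ hv₁).Gal ⥤ CosetCat (GaloisValDatum.ofPlace F₂ p₂ v₂ hv₂).Gal,
      OneUniqueSquare Ψ.functor
          (ofGalois (GaloisValDatum.ofPlace F₁ p₁ v₁ hv₁) (MonoidHom.id _) continuous_id Function.surjective_id
            IsOpenMap.id Kv₁ hp₁).toBase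
          (ofGalois (GaloisValDatum.ofPlace F₂ p₂ v₂ hv₂) (MonoidHom.id _) continuous_id Function.surjective_id
            IsOpenMap.id Kv₂ hp₂).toBase ΨBase ∧
        IsRigidFunctor (Ψ.functor ⋙
          (ofGalois (GaloisValDatum.ofPlace F₂ p₂ v₂ hv₂) (MonoidHom.id _) continuous_id Function.surjective_id
            IsOpenMap.id Kv₂ hp₂).toBase) ∧
        IsRigidFunctor
          ((ofGalois (GaloisValDatum.ofPlace F₁ p₁ v₁ hv₁) (MonoidHom.id _) continuous_id Function.surjective_id
            IsOpenMap.id Kv₁ hp₁).toBase ⋙ ΨBase) :=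
  exists_oneUniqueSquare_base_cosetCat _ _ (isSlim_cosetCat_of_isSlimGroup (isSlimGroup_gal_ofPlace F₁ p₁ v₁ hv₁))
    (isSlim_cosetCat_of_isSlimGroup (isSlimGroup_gal_ofPlace F₂ p₂ v₂ hv₂)) Ψ

end OfPlace

end GoodLocalFrobenioid

end Literature.IUT.HodgeTheaters

end
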